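import Summits.CriticalPhenomena.PercolationContinuityZ3.Theorems.PercNearOneGluingNoHeavyQuantSDEC
import HarnessLib

/-!
# QUANT lane: the rows `k ≥ q·T₂` of the gated heavy node reduce to THEOREM A on a de-phantomed pair (the "♯ removal")

builds on p205010 (kernel theorem, internal audit signed; external expert review pending)

Support file (`--supports stmt-CriticalPhenomena-4575`), QUANT lane seat prim-quant-arm-1 (gen 42); memo
`run/shared/lean/prim/quant/prim-quant-arm-1-g42/PHANTOM-ROWS-G42.md` §2/§5.  Imports only `…QuantSDEC` (`gate`, `lconv`); no
definitions, no sorries, standard axioms.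

THE OBSERVATION (`u = y/(1−y)`, `ε = u(1−q)/q`, `t = q(T₁+T₂)`).  Let row `k` of `gate (lconv M₁ M₂ μ₁ μ₂) q` lie above the small
factor's gated target, `q·T₂ ≤ k` (`2k < t`).  Then `t − k ≤ q·T₁`, so the `c = 0` gated row of `μ₁` gives `Σ_{a ≥ t−k} μ₁ a ≥ ε`
(`sharp_tail_of_rowZero`); let `φ` be the `ε`-portion of `μ₁` on `{a ≥ t−k}`.  (i) `μ₁ − φ` keeps the UNGATED
two-layer rows at target `q·T₁` — left sides unchanged (`φ` lives above `t−k > t/2 > c`), right sides drop by at most `ε`, exactly the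
slack of the gated rows (`sharp_factor_rows`); (ii) Theorem A (prim-quant-arm-2 g38, `twoLayer_lconv_of_half_le`, in its free-target
paper form: rate `u ≥ 1`, targets `qT₁, qT₂`) gives `u·((μ₁−φ)∗μ₂)[0,k] ≤ ((μ₁−φ)∗μ₂)[t−k,∞)`; (iii) `φ∗μ₂` has no mass `≤ k` and
all its mass `ε` at `≥ t−k`, and `q·ε = u(1−q)` is the gate's atom at `0` weighted by `u` — adding up gives the gated row `k`
(`gateConv_row_of_sharp`).  With `gateConv_row_belowTargets` (✓ `…QuantTLBBelowTargets`, arm-3 g165: every row `k < q·min Tᵢ`, no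
factor hypothesis) this covers EVERY row of `TLBGateConvClosedHeavy`; the one outstanding kernel input is Theorem A with the target as
a free parameter (`twoLayer_pair_of_certificate` ties it to `q·mean`), isolated as the hypothesis `hThmA` of
`gateConv_row_aboveTarget_of_thmA`.  EXACT CHECK (memo §5, `code/fullcheck.py`): 212 such rows on random LP-vertex law pairs —
premise, rows of `μ₁−φ`, Theorem A's conclusion for `(μ₁−φ, μ₂)` and the accounting identity all exact, 0 failures.
HONEST STATUS: `TLBGateConvClosedHeavy` / `FarTreeRowHeavy` remain conjectures in the tree until the free-target Theorem A lands;
nothing here is a published result; RATE class log\* unchanged.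

[this work]; Theorem A: prim-quant-arm-2 g38 (this lane).  The rows served belong to the gluing programme of
[cite: KozmaNitzan2024, Conjecture 3 (p. 15)].
-/

noncomputable section

namespace Summit.CriticalPhenomena.PercolationContinuityZ3.Theorems

namespace Quant

open Finset

namespace LawDec

/-- a test function against the convolution (as in `…QuantTLBBelowTargets`). [this work] -/
private theorem sh_sum_fun_mul_lconv (M₁ M₂ : ℕ) (μ₁ μ₂ : ℕ → ℝ) (ψ : ℕ → ℝ) :
    ∑ h ∈ Finset.range (M₁ + M₂ + 1), ψ h * lconv M₁ M₂ μ₁ μ₂ h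
      = ∑ a ∈ Finset.range (M₁ + 1), ∑ s ∈ Finset.range (M₂ + 1), ψ (a + s) * (μ₁ a * μ₂ s) := by
  simp only [lconv, Finset.mul_sum]
  rw [Finset.sum_comm]
  refine Finset.sum_congr rfl fun a ha => ?_
  rw [Finset.sum_comm]
  refine Finset.sum_congr rfl fun s hs => ?_
  rw [Finset.mem_range] at ha hs
  have e : ∀ h : ℕ, ψ h * (if a + s = h then μ₁ a * μ₂ s else 0) = if a + s = h then ψ (a + s) * (μ₁ a * μ₂ s) else 0 :=
    fun h => by split_ifs with hh <;> simp [hh]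
  simp_rw [e]
  rw [Finset.sum_ite_eq (Finset.range (M₁ + M₂ + 1)) (a + s), if_pos (Finset.mem_range.2 (by omega))]

/-- `lconv` is additive in the first factor, pointwise. [this work] -/
private theorem sh_lconv_sub_left (M₁ M₂ : ℕ) (μ₁ φ μ₂ : ℕ → ℝ) (h : ℕ) :
    lconv M₁ M₂ μ₁ μ₂ h = lconv M₁ M₂ (fun a => μ₁ a - φ a) μ₂ h + lconv M₁ M₂ φ μ₂ h := by
  simp only [lconv, ← Finset.sum_add_distrib]
  refine Finset.sum_congr rfl fun i _ => Finset.sum_congr rfl fun j _ => ?_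
  split_ifs
  · ring
  · simp

/-- **THE ♯ REDUCTION.**  Floor `0 < y < 1`, gate `0 < q`, `μ₂` of mass `1`, a row `k` with `2k < q(T₁+T₂)`, and a weight `φ` supported
on `{a : q(T₁+T₂) − k ≤ a}` with `Σ_{a ≤ M₁} φ a = (y/(1−y))(1−q)/q` (the phantom mass): the Theorem-A-shaped row `k` of
`lconv (μ₁−φ) μ₂` at threshold `q(T₁+T₂) − k` implies the two-layer row `k` of `gate (lconv μ₁ μ₂) q` (`φ∗μ₂` has no mass `≤ k` and all
of it above the threshold; `q·Σφ = u(1−q)` is the gate's atom at `0` weighted by `u`). [this work] -/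
theorem gateConv_row_of_sharp {y q T₁ T₂ : ℝ} {M₁ M₂ k : ℕ} {μ₁ μ₂ φ : ℕ → ℝ}
    (hy0 : 0 < y) (hy1 : y < 1) (hq0 : 0 < q)
    (h21 : ∑ h ∈ Finset.range (M₂ + 1), μ₂ h = 1)
    (hφs : ∀ a : ℕ, (a : ℝ) < q * (T₁ + T₂) - k → φ a = 0)
    (hφ1 : ∑ a ∈ Finset.range (M₁ + 1), φ a = y / (1 - y) * ((1 - q) / q))
    (h2k : 2 * (k : ℝ) < q * (T₁ + T₂))
    (hA : y / (1 - y) * ∑ h ∈ Finset.range (k + 1), lconv M₁ M₂ (fun a => μ₁ a - φ a) μ₂ h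
      ≤ ∑ h ∈ Finset.range (M₁ + M₂ + 1),
          (if q * (T₁ + T₂) - k ≤ (h : ℝ) then lconv M₁ M₂ (fun a => μ₁ a - φ a) μ₂ h else 0)) :
    y / (1 - y) * ∑ h ∈ Finset.range (k + 1), gate (lconv M₁ M₂ μ₁ μ₂) q h
      ≤ ∑ h ∈ Finset.range (M₁ + M₂ + 1),
          (if q * (T₁ + T₂) - k ≤ (h : ℝ) then gate (lconv M₁ M₂ μ₁ μ₂) q h else 0) := by
  have h1y : 0 < 1 - y := by linarith
  set u : ℝ := y / (1 - y) with hu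
  have hu0 : 0 < u := div_pos hy0 h1y
  set t : ℝ := q * (T₁ + T₂) with ht
  set L : ℕ → ℝ := lconv M₁ M₂ μ₁ μ₂ with hL
  set L' : ℕ → ℝ := lconv M₁ M₂ (fun a => μ₁ a - φ a) μ₂ with hL'
  set Lφ : ℕ → ℝ := lconv M₁ M₂ φ μ₂ with hLφ
  have hkr : (0 : ℝ) ≤ k := Nat.cast_nonneg k
  have htk : (k : ℝ) < t - k := by linarith
  -- (1) pointwise decomposition
  have hdec : ∀ h, L h = L' h + Lφ h := fun h => sh_lconv_sub_left M₁ M₂ μ₁ φ μ₂ h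
  -- (2) the low part of `φ ∗ μ₂` vanishes
  have hLφ_low : ∀ h ∈ Finset.range (k + 1), Lφ h = 0 := by
    intro h hh
    rw [Finset.mem_range] at hh
    simp only [hLφ, lconv]
    refine Finset.sum_eq_zero fun i _ => Finset.sum_eq_zero fun j _ => ?_
    split_ifs with hij
    · have hik : i ≤ k := by omega
      have hi : (i : ℝ) < q * (T₁ + T₂) - k := by
        have : (i : ℝ) ≤ k := by exact_mod_cast hik
        linarith
      rw [hφs i hi, zero_mul]
    · rfl
  -- (3) the high part of `φ ∗ μ₂` is the whole of it: `Σφ · Σμ₂`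
  have hLφ_high : ∑ h ∈ Finset.range (M₁ + M₂ + 1), (if t - k ≤ (h : ℝ) then Lφ h else 0)
      = ∑ a ∈ Finset.range (M₁ + 1), φ a := by
    have e1 : ∑ h ∈ Finset.range (M₁ + M₂ + 1), (if t - k ≤ (h : ℝ) then Lφ h else 0)
        = ∑ h ∈ Finset.range (M₁ + M₂ + 1), (if t - k ≤ (h : ℝ) then (1 : ℝ) else 0) * Lφ h := by
      refine Finset.sum_congr rfl fun h _ => ?_
      split_ifs <;> simp
    rw [e1, hLφ, sh_sum_fun_mul_lconv]
    have e2 : ∀ a ∈ Finset.range (M₁ + 1),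
        ∑ s ∈ Finset.range (M₂ + 1), (if t - k ≤ (((a + s : ℕ) : ℝ)) then (1 : ℝ) else 0) * (φ a * μ₂ s) = φ a := by
      intro a _
      by_cases hφa : φ a = 0
      · rw [hφa]
        simp
      · have hta : t - k ≤ (a : ℝ) := by
          by_contra hlt
          exact hφa (hφs a (by rw [ht]; linarith [not_le.mp hlt]))
        have e3 : ∀ s ∈ Finset.range (M₂ + 1),
            (if t - k ≤ (((a + s : ℕ) : ℝ)) then (1 : ℝ) else 0) * (φ a * μ₂ s) = φ a * μ₂ s := by
          intro s _
          have : t - k ≤ ((a + s : ℕ) : ℝ) := by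
            push_cast
            have : (0 : ℝ) ≤ s := Nat.cast_nonneg s
            linarith
          rw [if_pos this, one_mul]
        rw [Finset.sum_congr rfl e3, ← Finset.mul_sum, h21, mul_one]
    exact Finset.sum_congr rfl e2
  -- (4) the gated low sum: `(1−q) + q·Σ_{h ≤ k} L h`, and `Σ_{h≤k} L = Σ_{h≤k} L'`
  have hlowL : ∑ h ∈ Finset.range (k + 1), L h = ∑ h ∈ Finset.range (k + 1), L' h := by
    refine Finset.sum_congr rfl fun h hh => ?_
    rw [hdec h, hLφ_low h hh, add_zero]
  have hlow : ∑ h ∈ Finset.range (k + 1), gate L q h = (1 - q) + q * ∑ h ∈ Finset.range (k + 1), L' h := by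
    rw [← hlowL]
    simp only [gate]
    rw [Finset.sum_add_distrib, ← Finset.mul_sum, Finset.sum_ite_eq' (Finset.range (k + 1)) 0,
      if_pos (Finset.mem_range.2 (Nat.succ_pos k))]
    ring
  -- (5) the gated high sum: `q·(high L' + Σφ)` (no atom at `0` under the indicator since `t − k > 0`)
  have hhigh : ∑ h ∈ Finset.range (M₁ + M₂ + 1), (if t - k ≤ (h : ℝ) then gate L q h else 0)
      = q * (∑ h ∈ Finset.range (M₁ + M₂ + 1), (if t - k ≤ (h : ℝ) then L' h else 0))
        + q * ∑ a ∈ Finset.range (M₁ + 1), φ a := by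
    rw [← hLφ_high, Finset.mul_sum, Finset.mul_sum, ← Finset.sum_add_distrib]
    refine Finset.sum_congr rfl fun h _ => ?_
    by_cases hth : t - k ≤ (h : ℝ)
    · rw [if_pos hth, if_pos hth, if_pos hth]
      have hne : h ≠ 0 := by rintro rfl; rw [Nat.cast_zero] at hth; linarith
      simp only [gate, if_neg hne, add_zero]
      rw [hdec h]
      ring
    · rw [if_neg hth, if_neg hth, if_neg hth]
      ring
  -- (6) assemble
  rw [hlow, hhigh, hφ1]
  have hqε : q * (y / (1 - y) * ((1 - q) / q)) = y / (1 - y) * (1 - q) := by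
    field_simp
  rw [hqε]
  have hA' : q * (u * ∑ h ∈ Finset.range (k + 1), L' h)
      ≤ q * ∑ h ∈ Finset.range (M₁ + M₂ + 1), (if t - k ≤ (h : ℝ) then L' h else 0) :=
    mul_le_mul_of_nonneg_left hA hq0.le
  nlinarith [hA']

/-- **`μ₁ − φ` keeps the two-layer rows.**  If `gate μ₁ q` satisfies its rows `u·Σ_{h ≤ c} ≤ Σ_{qT₁−c ≤ h}` (`2c < qT₁`) and `φ ≥ 0` has
mass `u(1−q)/q` on `{0..M₁}` and vanishes below some `θ ≥ qT₁/2`, then the UNGATED `μ₁ − φ` satisfies `u·Σ_{h ≤ c}(μ₁−φ) ≤ Σ_{qT₁−c ≤ h}(μ₁−φ)`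
for all `2c < qT₁` — the hypotheses of Theorem A at target `qT₁`. [this work] -/
theorem sharp_factor_rows {y q T₁ θ : ℝ} {M₁ : ℕ} {μ₁ φ : ℕ → ℝ}
    (hy0 : 0 < y) (hy1 : y < 1) (hq0 : 0 < q)
    (hφ0 : ∀ a, 0 ≤ φ a) (hφs : ∀ a : ℕ, (a : ℝ) < θ → φ a = 0) (hθ : q * T₁ / 2 ≤ θ)
    (hφ1 : ∑ a ∈ Finset.range (M₁ + 1), φ a = y / (1 - y) * ((1 - q) / q))
    (hrow : ∀ c : ℕ, 2 * (c : ℝ) < q * T₁ →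
      y / (1 - y) * ∑ h ∈ Finset.range (c + 1), gate μ₁ q h
        ≤ ∑ h ∈ Finset.range (M₁ + 1), (if q * T₁ - c ≤ (h : ℝ) then gate μ₁ q h else 0))
    (c : ℕ) (hc : 2 * (c : ℝ) < q * T₁) :
    y / (1 - y) * ∑ h ∈ Finset.range (c + 1), (μ₁ h - φ h)
      ≤ ∑ h ∈ Finset.range (M₁ + 1), (if q * T₁ - c ≤ (h : ℝ) then μ₁ h - φ h else 0) := by
  have h1y : 0 < 1 - y := by linarith
  set u : ℝ := y / (1 - y) with hu
  have hu0 : 0 < u := div_pos hy0 h1y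
  have hcr : (0 : ℝ) ≤ c := Nat.cast_nonneg c
  -- the gated row, unfolded: `u(1−q) + u q Σ_{≤c} μ₁ ≤ q Σ_{[qT₁−c ≤ h]} μ₁`
  have hg := hrow c hc
  have hlow : ∑ h ∈ Finset.range (c + 1), gate μ₁ q h = (1 - q) + q * ∑ h ∈ Finset.range (c + 1), μ₁ h := by
    simp only [gate]
    rw [Finset.sum_add_distrib, ← Finset.mul_sum, Finset.sum_ite_eq' (Finset.range (c + 1)) 0,
      if_pos (Finset.mem_range.2 (Nat.succ_pos c))]
    ring
  have hhigh : ∑ h ∈ Finset.range (M₁ + 1), (if q * T₁ - c ≤ (h : ℝ) then gate μ₁ q h else 0)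
      = q * ∑ h ∈ Finset.range (M₁ + 1), (if q * T₁ - c ≤ (h : ℝ) then μ₁ h else 0) := by
    rw [Finset.mul_sum]
    refine Finset.sum_congr rfl fun h _ => ?_
    by_cases hth : q * T₁ - c ≤ (h : ℝ)
    · rw [if_pos hth, if_pos hth]
      have hne : h ≠ 0 := by rintro rfl; rw [Nat.cast_zero] at hth; linarith
      simp only [gate, if_neg hne, add_zero]
    · rw [if_neg hth, if_neg hth, mul_zero]
  rw [hlow, hhigh] at hg
  -- low side: `φ` vanishes on `{h ≤ c}` (`c < qT₁/2 ≤ θ`)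
  have hlowφ : ∑ h ∈ Finset.range (c + 1), (μ₁ h - φ h) = ∑ h ∈ Finset.range (c + 1), μ₁ h := by
    refine Finset.sum_congr rfl fun h hh => ?_
    rw [Finset.mem_range] at hh
    have : (h : ℝ) < θ := by
      have : (h : ℝ) ≤ c := by exact_mod_cast Nat.lt_succ_iff.mp hh
      linarith
    rw [hφs h this, sub_zero]
  -- high side: drops by at most `Σ φ`
  have hhighφ : ∑ h ∈ Finset.range (M₁ + 1), (if q * T₁ - c ≤ (h : ℝ) then μ₁ h - φ h else 0)
      ≥ ∑ h ∈ Finset.range (M₁ + 1), (if q * T₁ - c ≤ (h : ℝ) then μ₁ h else 0) - ∑ a ∈ Finset.range (M₁ + 1), φ a := by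
    rw [ge_iff_le, sub_le_iff_le_add, ← Finset.sum_add_distrib]
    refine Finset.sum_le_sum fun h _ => ?_
    split_ifs
    · linarith
    · linarith [hφ0 h]
  rw [hlowφ]
  rw [hφ1] at hhighφ
  -- `u(1−q)/q + u Σ_{≤c} μ₁ ≤ Σ_{high} μ₁` from `hg` divided by `q`
  have key : u * ((1 - q) / q) + u * ∑ h ∈ Finset.range (c + 1), μ₁ h
      ≤ ∑ h ∈ Finset.range (M₁ + 1), (if q * T₁ - c ≤ (h : ℝ) then μ₁ h else 0) := by
    have hg' : q * (u * ((1 - q) / q) + u * ∑ h ∈ Finset.range (c + 1), μ₁ h)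
        ≤ q * ∑ h ∈ Finset.range (M₁ + 1), (if q * T₁ - c ≤ (h : ℝ) then μ₁ h else 0) := by
      have e : q * (u * ((1 - q) / q) + u * ∑ h ∈ Finset.range (c + 1), μ₁ h)
          = u * ((1 - q) + q * ∑ h ∈ Finset.range (c + 1), μ₁ h) := by
        field_simp
      rw [e]
      exact hg
    exact le_of_mul_le_mul_left hg' hq0
  linarith

/-- the tail of `μ₁ ≥ 0` above a threshold `θ ≤ qT₁` is at least the phantom mass `u(1−q)/q`, by the `c = 0` gated row. [this work] -/
theorem sharp_tail_of_rowZero {y q T₁ θ : ℝ} {M₁ : ℕ} {μ₁ : ℕ → ℝ}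
    (hy0 : 0 < y) (hy1 : y < 1) (hq0 : 0 < q) (h10 : ∀ h, 0 ≤ μ₁ h) (hT1p : 0 < q * T₁) (hθ : θ ≤ q * T₁)
    (hrow0 : y / (1 - y) * ∑ h ∈ Finset.range (0 + 1), gate μ₁ q h
        ≤ ∑ h ∈ Finset.range (M₁ + 1), (if q * T₁ - (0 : ℕ) ≤ (h : ℝ) then gate μ₁ q h else 0)) :
    y / (1 - y) * ((1 - q) / q) ≤ ∑ h ∈ Finset.range (M₁ + 1), (if θ ≤ (h : ℝ) then μ₁ h else 0) := by
  have h1y : 0 < 1 - y := by linarith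
  set u : ℝ := y / (1 - y) with hu
  have hu0 : 0 < u := div_pos hy0 h1y
  rw [Finset.sum_range_one] at hrow0
  have hg0 : gate μ₁ q 0 = q * μ₁ 0 + (1 - q) := by simp [gate]
  rw [hg0, Nat.cast_zero, sub_zero] at hrow0
  have hhigh : ∑ h ∈ Finset.range (M₁ + 1), (if q * T₁ ≤ (h : ℝ) then gate μ₁ q h else 0)
      = q * ∑ h ∈ Finset.range (M₁ + 1), (if q * T₁ ≤ (h : ℝ) then μ₁ h else 0) := by
    rw [Finset.mul_sum]
    refine Finset.sum_congr rfl fun h _ => ?_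
    by_cases hth : q * T₁ ≤ (h : ℝ)
    · rw [if_pos hth, if_pos hth]
      have hne : h ≠ 0 := by rintro rfl; rw [Nat.cast_zero] at hth; linarith
      simp only [gate, if_neg hne, add_zero]
    · rw [if_neg hth, if_neg hth, mul_zero]
  rw [hhigh] at hrow0
  have hmono : ∑ h ∈ Finset.range (M₁ + 1), (if q * T₁ ≤ (h : ℝ) then μ₁ h else 0)
      ≤ ∑ h ∈ Finset.range (M₁ + 1), (if θ ≤ (h : ℝ) then μ₁ h else 0) := by
    refine Finset.sum_le_sum fun h _ => ?_
    by_cases hth : q * T₁ ≤ (h : ℝ)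
    · rw [if_pos hth, if_pos (le_trans hθ hth)]
    · rw [if_neg hth]
      split_ifs
      · exact h10 h
      · exact le_rfl
  have key : u * ((1 - q) / q) ≤ ∑ h ∈ Finset.range (M₁ + 1), (if q * T₁ ≤ (h : ℝ) then μ₁ h else 0) := by
    have e : q * (u * ((1 - q) / q)) = u * (1 - q) := by field_simp
    have h2 : q * (u * ((1 - q) / q)) ≤ q * ∑ h ∈ Finset.range (M₁ + 1), (if q * T₁ ≤ (h : ℝ) then μ₁ h else 0) := by
      rw [e]
      nlinarith [h10 0, mul_nonneg hu0.le (mul_nonneg hq0.le (h10 0))]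
    exact le_of_mul_le_mul_left h2 hq0
  exact key.trans hmono

/-- **ROWS `q·T₂ ≤ k` OF THE HEAVY NODE FROM THEOREM A (free-target instance).**  Floor `0 < y < 1`, gate `0 < q ≤ 1`, `μ₁ ≥ 0` on
`{0..M₁}` whose gated version has the two-layer rows at `qT₁ > 0`, `μ₂` of mass `1`, `0 ≤ T₂`, `q·T₂ ≤ k`, `2k < q(T₁+T₂)`: IF `hThmA` —
every nonnegative `ν₁` on `{0..M₁}` with the UNGATED rows at target `qT₁` gives, paired with `μ₂`, the row `k` of `lconv ν₁ μ₂` at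
threshold `q(T₁+T₂) − k` (= arm-2 g38's Theorem A with free targets at rate `u = y/(1−y) ≥ 1`, `μ₂`'s gated rows implying its ungated
rows with slack) — then `gate (lconv μ₁ μ₂) q` satisfies its row `k`.  Proof: `φ :=` the `ε`-portion of `μ₁` above `θ = q(T₁+T₂) − k ≤ qT₁`,
`sharp_tail_of_rowZero`, `sharp_factor_rows`, `gateConv_row_of_sharp`. [this work] -/
theorem gateConv_row_aboveTarget_of_thmA {y q T₁ T₂ : ℝ} {M₁ M₂ k : ℕ} {μ₁ μ₂ : ℕ → ℝ}
    (hy0 : 0 < y) (hy1 : y < 1) (hq0 : 0 < q) (hq1 : q ≤ 1)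
    (h10 : ∀ h, 0 ≤ μ₁ h) (h1M : ∀ h, M₁ < h → μ₁ h = 0)
    (h21 : ∑ h ∈ Finset.range (M₂ + 1), μ₂ h = 1)
    (hT1p : 0 < q * T₁)
    (hrow1 : ∀ c : ℕ, 2 * (c : ℝ) < q * T₁ →
      y / (1 - y) * ∑ h ∈ Finset.range (c + 1), gate μ₁ q h
        ≤ ∑ h ∈ Finset.range (M₁ + 1), (if q * T₁ - c ≤ (h : ℝ) then gate μ₁ q h else 0))
    (hT20 : 0 ≤ T₂) (hkT2 : q * T₂ ≤ k) (h2k : 2 * (k : ℝ) < q * (T₁ + T₂))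
    (hThmA : ∀ ν₁ : ℕ → ℝ, (∀ h, 0 ≤ ν₁ h) → (∀ h, M₁ < h → ν₁ h = 0) →
      (∀ c : ℕ, 2 * (c : ℝ) < q * T₁ →
        y / (1 - y) * ∑ h ∈ Finset.range (c + 1), ν₁ h
          ≤ ∑ h ∈ Finset.range (M₁ + 1), (if q * T₁ - c ≤ (h : ℝ) then ν₁ h else 0)) →
      y / (1 - y) * ∑ h ∈ Finset.range (k + 1), lconv M₁ M₂ ν₁ μ₂ h
        ≤ ∑ h ∈ Finset.range (M₁ + M₂ + 1), (if q * (T₁ + T₂) - k ≤ (h : ℝ) then lconv M₁ M₂ ν₁ μ₂ h else 0)) :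
    y / (1 - y) * ∑ h ∈ Finset.range (k + 1), gate (lconv M₁ M₂ μ₁ μ₂) q h
      ≤ ∑ h ∈ Finset.range (M₁ + M₂ + 1),
          (if q * (T₁ + T₂) - k ≤ (h : ℝ) then gate (lconv M₁ M₂ μ₁ μ₂) q h else 0) := by
  set θ : ℝ := q * (T₁ + T₂) - k with hθ
  have hθT : θ ≤ q * T₁ := by rw [hθ]; linarith
  have hθ2 : q * T₁ / 2 ≤ θ := by
    rw [hθ]
    have : 0 ≤ q * T₂ := mul_nonneg hq0.le hT20
    linarith
  -- the tail above `θ` and the explicit `ε`-portion `φ a = [θ ≤ a]·μ₁ a·(ε/S)`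
  have hrow0 := hrow1 0 (by rw [Nat.cast_zero, mul_zero]; exact hT1p)
  have htail := sharp_tail_of_rowZero (θ := θ) hy0 hy1 hq0 h10 hT1p hθT hrow0
  have h1y : 0 < 1 - y := by linarith
  set ε : ℝ := y / (1 - y) * ((1 - q) / q) with hε
  have hε0 : 0 ≤ ε := mul_nonneg (div_pos hy0 h1y).le (div_nonneg (by linarith) hq0.le)
  set S : ℝ := ∑ h ∈ Finset.range (M₁ + 1), (if θ ≤ (h : ℝ) then μ₁ h else 0) with hS
  have hS0 : 0 ≤ S := le_trans hε0 htail
  have hr0 : 0 ≤ ε / S := div_nonneg hε0 hS0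
  have hr1 : ε / S ≤ 1 := by
    rcases hS0.lt_or_eq with hpos | hzero
    · rw [div_le_one hpos]; exact htail
    · rw [← hzero, div_zero]; exact zero_le_one
  set φ : ℕ → ℝ := fun a => if θ ≤ (a : ℝ) then μ₁ a * (ε / S) else 0 with hφ
  have hφ0 : ∀ a, 0 ≤ φ a := fun a => by
    simp only [hφ]; split_ifs
    · exact mul_nonneg (h10 a) hr0
    · exact le_rfl
  have hφle : ∀ a, φ a ≤ μ₁ a := fun a => by
    simp only [hφ]; split_ifs
    · nlinarith [h10 a, hr1]
    · exact h10 a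
  have hφs : ∀ a : ℕ, (a : ℝ) < θ → φ a = 0 := fun a ha => by simp only [hφ, if_neg (not_le.mpr ha)]
  have hφM : ∀ a, M₁ < a → φ a = 0 := fun a ha => by simp only [hφ, h1M a ha, zero_mul, ite_self]
  have hφ1 : ∑ a ∈ Finset.range (M₁ + 1), φ a = y / (1 - y) * ((1 - q) / q) := by
    have e : ∑ a ∈ Finset.range (M₁ + 1), φ a = S * (ε / S) := by
      rw [hS, Finset.sum_mul]
      refine Finset.sum_congr rfl fun a _ => ?_
      simp only [hφ]; split_ifs
      · rfl
      · rw [zero_mul]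
    rw [e, ← hε]
    rcases hS0.lt_or_eq with hpos | hzero
    · field_simp
    · have hε00 : ε = 0 := le_antisymm (by rw [hzero]; exact htail) hε0
      rw [hε00, ← hzero, zero_mul]
  -- (i) the de-phantomed factor keeps its rows
  have hrows' : ∀ c : ℕ, 2 * (c : ℝ) < q * T₁ →
      y / (1 - y) * ∑ h ∈ Finset.range (c + 1), (μ₁ h - φ h)
        ≤ ∑ h ∈ Finset.range (M₁ + 1), (if q * T₁ - c ≤ (h : ℝ) then μ₁ h - φ h else 0) :=
    fun c hc => sharp_factor_rows hy0 hy1 hq0 hφ0 hφs hθ2 hφ1 hrow1 c hc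
  -- (ii) Theorem A for the de-phantomed pair
  have hA := hThmA (fun a => μ₁ a - φ a) (fun a => by linarith [hφle a]) (fun a ha => by
      show μ₁ a - φ a = 0
      rw [h1M a ha, hφM a ha, sub_zero]) hrows'
  -- (iii) the reduction
  exact gateConv_row_of_sharp hy0 hy1 hq0 h21 (fun a ha => hφs a ha) hφ1 h2k hA

end LawDec

end Quant

end Summit.CriticalPhenomena.PercolationContinuityZ3.Theorems
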